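import Summits.AtomisticToContinuum.Crystallization.Theses.DisclinationRation
import Summits.AtomisticToContinuum.Crystallization.Theorems.ChessboardParticlePlanesPeriodicWindowsGoodLimitB

/-!
# `AlphabetGoodHullElement` (crux stmt-AtomisticToContinuum-15798, route `DisclinationRation`),
# negative side I: energy minimality (and the potential) are load-bearing

The crux: every sequence `x N` of Lennard-Jones ground states in `ℝ³` has a ROOTED HULL ELEMENT
`S ∋ 0` (translates `x (φ j) + τ j` two-way `ε`-matched with `S` on every ball, eventually in `j`)
that is `δ`-separated, relatively dense and everywhere alphabet-good (fcc / hcp / decahedral-axis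
first shell at tolerance `1/20`).

This file (refuter, cdisprove seat, cycle 1) records, sorry-free and with the clauses SPELLED OUT
(no proposition is defined under `Summits/`):

* `chain_no_relDense_rooted_hullElement` — the collinear chain `x N i = i • e₀` has NO rooted hull
  element that is relatively dense: two matched particles pin the second coordinate of every point
  of `S` to that of `0`, while relative denseness produces a point of `S` with second coordinate
  `≥ 1`.
* `not_hullShape_of_injective` — hence "distinct particles" alone (the first conjunct of
  `IsGroundState`) does not give even the weakest part of the conclusion (root + hull + relative
  denseness), and `alphabetGoodHullElement_false_without_minimality` — the crux with
  `IsGroundState lennardJones (x N)` weakened to `Function.Injective (x N)` is FALSE (verbatim shape).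
* `not_hullShape_of_isGroundState_zero`, `alphabetGoodHullElement_false_for_zero_potential` — the
  same chain is a ground-state sequence of the ZERO potential (`isGroundState_zero`), so the crux's
  shape with `lennardJones` replaced by `fun _ => 0` is FALSE: the proof must use cohesion of the
  Lennard-Jones potential (three-dimensional, relatively dense local limits) before any shell
  pattern enters.  Compare `not_isCrystallizing_zero` (Literature `Crystallization.lean`).

Moral for provers: nothing in the conclusion is free except the normalisations (`0 ∈ S`,
`δ`-separation via `LennardJonesMinimalDistance_holds`); relative denseness of SOME hull element is
already an energetic statement.  This file does NOT refute the crux.  All `[folklore]`.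
-/

noncomputable section

namespace Summit.AtomisticToContinuum.Crystallization.Theorems.AlphabetGoodHullElementNegative

open Literature.MathematicalPhysics.StatisticalMechanics Filter
open Summit.AtomisticToContinuum.Crystallization.Theorems.PeriodicWindowsSketch (gl_coord_sub_le_dist)

/-- The collinear chain `i ↦ i • e₀` has distinct particles. [folklore] -/
theorem chain_injective (N : ℕ) :
    Function.Injective (fun i : Fin N => ((i : ℕ) : ℝ) • EuclideanSpace.single (0 : Fin 3) (1 : ℝ)) := by
  intro i j h
  have hv : (EuclideanSpace.single (0 : Fin 3) (1 : ℝ) : EuclideanSpace ℝ (Fin 3)) ≠ 0 := by simp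
  have h' : ((i : ℕ) : ℝ) = ((j : ℕ) : ℝ) := smul_left_injective ℝ hv h
  exact Fin.ext (by exact_mod_cast h')

/-- **The collinear chain has no relatively dense rooted hull element.** If `S ∋ 0` is two-way
matched on every ball with translates of the chains `x N i = i • e₀` along a subsequence, then `S`
is not relatively dense (its points have vanishing second coordinate). [folklore] -/
theorem chain_no_relDense_rooted_hullElement (S : Set (EuclideanSpace ℝ (Fin 3)))
    (h0 : (0 : EuclideanSpace ℝ (Fin 3)) ∈ S)
    (hHL : ∃ φ : ℕ → ℕ, StrictMono φ ∧ ∃ τ : ℕ → EuclideanSpace ℝ (Fin 3), ∀ R ε : ℝ, 0 < ε →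
      ∀ᶠ j : ℕ in Filter.atTop,
        (∀ s ∈ S, ‖s‖ ≤ R → ∃ i : Fin (φ j),
          dist ((fun (N : ℕ) (i : Fin N) => ((i : ℕ) : ℝ) • EuclideanSpace.single (0 : Fin 3) (1 : ℝ))
            (φ j) i + τ j) s ≤ ε) ∧
        (∀ i : Fin (φ j),
          ‖(fun (N : ℕ) (i : Fin N) => ((i : ℕ) : ℝ) • EuclideanSpace.single (0 : Fin 3) (1 : ℝ))
            (φ j) i + τ j‖ ≤ R → ∃ s ∈ S,
          dist ((fun (N : ℕ) (i : Fin N) => ((i : ℕ) : ℝ) • EuclideanSpace.single (0 : Fin 3) (1 : ℝ))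
            (φ j) i + τ j) s ≤ ε))
    (hRD : ∃ R₁ : ℝ, ∀ p : EuclideanSpace ℝ (Fin 3), ∃ y ∈ S, dist y p ≤ R₁) : False := by
  obtain ⟨φ, -, τ, hmatch⟩ := hHL
  obtain ⟨R₁, hR₁⟩ := hRD
  obtain ⟨y, hyS, hyq⟩ := hR₁ (EuclideanSpace.single (1 : Fin 3) (|R₁| + 1))
  -- the second coordinate of `y` is at least `1`
  have hy1 : 1 ≤ y 1 := by
    have h := gl_coord_sub_le_dist y (EuclideanSpace.single (1 : Fin 3) (|R₁| + 1)) 1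
    have hq : (EuclideanSpace.single (1 : Fin 3) (|R₁| + 1) : EuclideanSpace ℝ (Fin 3)) 1 = |R₁| + 1 := by
      simp
    rw [hq] at h
    have h' : |y 1 - (|R₁| + 1)| ≤ |R₁| := (h.trans hyq).trans (le_abs_self R₁)
    have h'' := (abs_le.1 h').1
    linarith
  -- match at radius `‖y‖`, tolerance `1/4`: a particle near `y`, a particle near `0`
  obtain ⟨j, hj⟩ := (hmatch ‖y‖ (1 / 4) (by norm_num)).exists
  obtain ⟨i, hi⟩ := hj.1 y hyS le_rfl
  obtain ⟨i', hi'⟩ := hj.1 0 h0 (by simp)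
  have e1 : ((((i : ℕ) : ℝ) • EuclideanSpace.single (0 : Fin 3) (1 : ℝ) : EuclideanSpace ℝ (Fin 3)) + τ j) 1
      = τ j 1 := by simp
  have e2 : ((((i' : ℕ) : ℝ) • EuclideanSpace.single (0 : Fin 3) (1 : ℝ) : EuclideanSpace ℝ (Fin 3)) + τ j) 1
      = τ j 1 := by simp
  have a1 := gl_coord_sub_le_dist
    ((((i : ℕ) : ℝ) • EuclideanSpace.single (0 : Fin 3) (1 : ℝ) : EuclideanSpace ℝ (Fin 3)) + τ j) y 1
  have a2 := gl_coord_sub_le_dist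
    ((((i' : ℕ) : ℝ) • EuclideanSpace.single (0 : Fin 3) (1 : ℝ) : EuclideanSpace ℝ (Fin 3)) + τ j) 0 1
  rw [e1] at a1
  rw [e2] at a2
  have b1 := abs_le.1 (a1.trans hi)
  have b2 := abs_le.1 (a2.trans hi')
  have hz : (0 : EuclideanSpace ℝ (Fin 3)) 1 = 0 := rfl
  rw [hz] at b2
  linarith [b1.1, b1.2, b2.1, b2.2]

/-- **Injectivity alone gives nothing**: it is false that every family of configurations of
DISTINCT points has a rooted, relatively dense hull element (witness: the collinear chain).
[folklore] -/
theorem not_hullShape_of_injective :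
    ¬ ∀ x : (N : ℕ) → (Fin N → EuclideanSpace ℝ (Fin 3)), (∀ N, Function.Injective (x N)) →
      ∃ S : Set (EuclideanSpace ℝ (Fin 3)), (0 : EuclideanSpace ℝ (Fin 3)) ∈ S ∧
        (∃ φ : ℕ → ℕ, StrictMono φ ∧ ∃ τ : ℕ → EuclideanSpace ℝ (Fin 3), ∀ R ε : ℝ, 0 < ε →
          ∀ᶠ j : ℕ in Filter.atTop,
            (∀ s ∈ S, ‖s‖ ≤ R → ∃ i : Fin (φ j), dist (x (φ j) i + τ j) s ≤ ε) ∧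
            (∀ i : Fin (φ j), ‖x (φ j) i + τ j‖ ≤ R → ∃ s ∈ S, dist (x (φ j) i + τ j) s ≤ ε)) ∧
        (∃ R₁ : ℝ, ∀ p : EuclideanSpace ℝ (Fin 3), ∃ y ∈ S, dist y p ≤ R₁) := by
  intro h
  obtain ⟨S, h0, hHL, hRD⟩ :=
    h (fun (N : ℕ) (i : Fin N) => ((i : ℕ) : ℝ) • EuclideanSpace.single (0 : Fin 3) (1 : ℝ)) chain_injective
  exact chain_no_relDense_rooted_hullElement S h0 hHL hRD

/-- **`AlphabetGoodHullElement` is false without energy minimality** — the crux VERBATIM with its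
hypothesis `IsGroundState lennardJones (x N)` weakened to its first conjunct
`Function.Injective (x N)`. Any proof must use minimality. [folklore] -/
theorem alphabetGoodHullElement_false_without_minimality :
    ¬ (let GA : Set (EuclideanSpace ℝ (Fin 3)) → EuclideanSpace ℝ (Fin 3) → Prop := fun S y => let d : ℝ := sInf ((fun z => dist z y) '' (S \ {y})); let T : Set (EuclideanSpace ℝ (Fin 3)) := {z : EuclideanSpace ℝ (Fin 3) | z ∈ S ∧ z ≠ y ∧ dist z y < 13 / 10 * d}; ∃ A : EuclideanSpace ℝ (Fin 3) →ₗᵢ[ℝ] EuclideanSpace ℝ (Fin 3), (∃ e : ↥T ≃ ↥Literature.Geometry.DiscreteGeometry.fccKissingPattern, ∀ t : ↥T, dist (d⁻¹ • ((t : EuclideanSpace ℝ (Fin 3)) - y)) (A ((e t : ↥Literature.Geometry.DiscreteGeometry.fccKissingPattern) : EuclideanSpace ℝ (Fin 3))) ≤ 1 / 20) ∨ (∃ e : ↥T ≃ ↥Literature.Geometry.DiscreteGeometry.hcpKissingPattern, ∀ t : ↥T, dist (d⁻¹ • ((t : EuclideanSpace ℝ (Fin 3)) - y)) (A ((e t :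 ↥Literature.Geometry.DiscreteGeometry.hcpKissingPattern) : EuclideanSpace ℝ (Fin 3))) ≤ 1 / 20) ∨ (∃ e : ↥T ≃ ↥{p : EuclideanSpace ℝ (Fin 3) | p = !₂[(0 : ℝ), 0, 1] ∨ p = !₂[(0 : ℝ), 0, -1] ∨ ∃ k : Fin 5, ∃ σ : ℝ, (σ = 1 / 2 ∨ σ = -(1 / 2)) ∧ p = !₂[Real.sqrt 3 / 2 * Real.cos (2 * Real.pi * (k : ℝ) / 5), Real.sqrt 3 / 2 * Real.sin (2 * Real.pi * (k : ℝ) / 5), σ]}, ∀ t : ↥T, dist (d⁻¹ • ((t : EuclideanSpace ℝ (Fin 3)) - y)) (A ((e t : ↥{p : EuclideanSpace ℝ (Fin 3) | p = !₂[(0 : ℝ), 0, 1] ∨ p = !₂[(0 : ℝ), 0, -1] ∨ ∃ k : Fin 5, ∃ σ : ℝ, (σ = 1 / 2 ∨ σ = -(1 / 2)) ∧ p = !₂[Real.sqrt 3 / 2 * Real.cos (2 * Real.pi * (k : ℝ) / 5), Real.sqrt 3 / 2 * Real.sin (2 * Real.pi * (k : ℝ) / 5), σ]}) : EuclideanSpace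 ℝ (Fin 3))) ≤ 1 / 20); let HL : ((N : ℕ) → (Fin N → EuclideanSpace ℝ (Fin 3))) → Set (EuclideanSpace ℝ (Fin 3)) → Prop := fun x S => ∃ φ : ℕ → ℕ, StrictMono φ ∧ ∃ τ : ℕ → EuclideanSpace ℝ (Fin 3), ∀ R ε : ℝ, 0 < ε → ∀ᶠ j : ℕ in Filter.atTop, (∀ s ∈ S, ‖s‖ ≤ R → ∃ i : Fin (φ j), dist (x (φ j) i + τ j) s ≤ ε) ∧ (∀ i : Fin (φ j), ‖x (φ j) i + τ j‖ ≤ R → ∃ s ∈ S, dist (x (φ j) i + τ j) s ≤ ε); ∀ (x : (N : ℕ) → (Fin N → EuclideanSpace ℝ (Fin 3))), (∀ N, Function.Injective (x N)) → ∃ S : Set (EuclideanSpace ℝ (Fin 3)), ∃ δ : ℝ, 0 < δ ∧ (∀ y ∈ S, ∀ z ∈ S, y ≠ z → δ ≤ dist y z) ∧ (0 : EuclideanSpace ℝ (Fin 3)) ∈ S ∧ HL x S ∧ (∀ y ∈ S, GA S y) ∧ (∃ R₁ : ℝ, ∀ p : EuclideanSpace ℝ (Fin 3), ∃ y ∈ S,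 dist y p ≤ R₁)) := by
  intro h
  refine not_hullShape_of_injective fun x hx => ?_
  obtain ⟨S, δ, -, -, h0, hHL, -, hRD⟩ := h x hx
  exact ⟨S, h0, hHL, hRD⟩

/-- **Ground states of the zero potential give nothing**: it is false that every ground-state
sequence of the ZERO potential has a rooted, relatively dense hull element (the collinear chain is
such a sequence, `isGroundState_zero`). [folklore] -/
theorem not_hullShape_of_isGroundState_zero :
    ¬ ∀ x : (N : ℕ) → (Fin N → EuclideanSpace ℝ (Fin 3)), (∀ N, IsGroundState (fun _ => 0) (x N)) →
      ∃ S : Set (EuclideanSpace ℝ (Fin 3)), (0 : EuclideanSpace ℝ (Fin 3)) ∈ S ∧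
        (∃ φ : ℕ → ℕ, StrictMono φ ∧ ∃ τ : ℕ → EuclideanSpace ℝ (Fin 3), ∀ R ε : ℝ, 0 < ε →
          ∀ᶠ j : ℕ in Filter.atTop,
            (∀ s ∈ S, ‖s‖ ≤ R → ∃ i : Fin (φ j), dist (x (φ j) i + τ j) s ≤ ε) ∧
            (∀ i : Fin (φ j), ‖x (φ j) i + τ j‖ ≤ R → ∃ s ∈ S, dist (x (φ j) i + τ j) s ≤ ε)) ∧
        (∃ R₁ : ℝ, ∀ p : EuclideanSpace ℝ (Fin 3), ∃ y ∈ S, dist y p ≤ R₁) := by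
  intro h
  obtain ⟨S, h0, hHL, hRD⟩ :=
    h (fun (N : ℕ) (i : Fin N) => ((i : ℕ) : ℝ) • EuclideanSpace.single (0 : Fin 3) (1 : ℝ))
      fun N => isGroundState_zero (chain_injective N)
  exact chain_no_relDense_rooted_hullElement S h0 hHL hRD

/-- **The potential is load-bearing** — the crux VERBATIM with `lennardJones` replaced by the zero
potential `fun _ => 0` is FALSE. Any proof must use cohesion of the Lennard-Jones potential.
[folklore] -/
theorem alphabetGoodHullElement_false_for_zero_potential :
    ¬ (let GA : Set (EuclideanSpace ℝ (Fin 3)) → EuclideanSpace ℝ (Fin 3) → Prop := fun S y => let d : ℝ := sInf ((fun z => dist z y) '' (S \ {y})); let T : Set (EuclideanSpace ℝ (Fin 3)) := {z : EuclideanSpace ℝ (Fin 3) | z ∈ S ∧ z ≠ y ∧ dist z y < 13 / 10 * d}; ∃ A : EuclideanSpace ℝ (Fin 3) →ₗᵢ[ℝ] EuclideanSpace ℝ (Fin 3), (∃ e : ↥T ≃ ↥Literature.Geometry.DiscreteGeometry.fccKissingPattern, ∀ t : ↥T, dist (d⁻¹ • ((t : EuclideanSpace ℝ (Fin 3)) -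 y)) (A ((e t : ↥Literature.Geometry.DiscreteGeometry.fccKissingPattern) : EuclideanSpace ℝ (Fin 3))) ≤ 1 / 20) ∨ (∃ e : ↥T ≃ ↥Literature.Geometry.DiscreteGeometry.hcpKissingPattern, ∀ t : ↥T, dist (d⁻¹ • ((t : EuclideanSpace ℝ (Fin 3)) - y)) (A ((e t : ↥Literature.Geometry.DiscreteGeometry.hcpKissingPattern) : EuclideanSpace ℝ (Fin 3))) ≤ 1 / 20) ∨ (∃ e : ↥T ≃ ↥{p : EuclideanSpace ℝ (Fin 3) | p = !₂[(0 : ℝ), 0, 1] ∨ p = !₂[(0 : ℝ), 0, -1] ∨ ∃ k : Fin 5, ∃ σ : ℝ, (σ = 1 / 2 ∨ σ = -(1 / 2)) ∧ p = !₂[Real.sqrt 3 / 2 * Real.cos (2 * Real.pi * (k : ℝ) / 5), Real.sqrt 3 / 2 * Real.sin (2 * Real.pi * (k : ℝ) / 5), σ]}, ∀ t : ↥T, dist (d⁻¹ • ((t : EuclideanSpace ℝ (Fin 3)) - y)) (A ((e t : ↥{p : EuclideanSpace ℝ (Fin 3) | p = !₂[(0 : ℝ), 0, 1] ∨ p = !₂[(0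 : ℝ), 0, -1] ∨ ∃ k : Fin 5, ∃ σ : ℝ, (σ = 1 / 2 ∨ σ = -(1 / 2)) ∧ p = !₂[Real.sqrt 3 / 2 * Real.cos (2 * Real.pi * (k : ℝ) / 5), Real.sqrt 3 / 2 * Real.sin (2 * Real.pi * (k : ℝ) / 5), σ]}) : EuclideanSpace ℝ (Fin 3))) ≤ 1 / 20); let HL : ((N : ℕ) → (Fin N → EuclideanSpace ℝ (Fin 3))) → Set (EuclideanSpace ℝ (Fin 3)) → Prop := fun x S => ∃ φ : ℕ → ℕ, StrictMono φ ∧ ∃ τ : ℕ → EuclideanSpace ℝ (Fin 3), ∀ R ε : ℝ, 0 < ε → ∀ᶠ j : ℕ in Filter.atTop, (∀ s ∈ S, ‖s‖ ≤ R → ∃ i : Fin (φ j), dist (x (φ j) i + τ j) s ≤ ε) ∧ (∀ i : Fin (φ j), ‖x (φ j) i + τ j‖ ≤ R → ∃ s ∈ S, dist (x (φ j) i + τ j) s ≤ ε); ∀ (x : (N : ℕ) → (Fin N → EuclideanSpace ℝ (Fin 3))), (∀ N, IsGroundState (fun _ => (0 : ℝ)) (x N)) → ∃ S : Set (EuclideanSpace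 ℝ (Fin 3)), ∃ δ : ℝ, 0 < δ ∧ (∀ y ∈ S, ∀ z ∈ S, y ≠ z → δ ≤ dist y z) ∧ (0 : EuclideanSpace ℝ (Fin 3)) ∈ S ∧ HL x S ∧ (∀ y ∈ S, GA S y) ∧ (∃ R₁ : ℝ, ∀ p : EuclideanSpace ℝ (Fin 3), ∃ y ∈ S, dist y p ≤ R₁)) := by
  intro h
  refine not_hullShape_of_isGroundState_zero fun x hx => ?_
  obtain ⟨S, δ, -, -, h0, hHL, -, hRD⟩ := h x hx
  exact ⟨S, h0, hHL, hRD⟩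

end Summit.AtomisticToContinuum.Crystallization.Theorems.AlphabetGoodHullElementNegative

end
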